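import Literature.NumberTheory.NumberFields.CubicFieldExplicit
import Mathlib.NumberTheory.NumberField.Norm
import Mathlib.RingTheory.Ideal.Norm.AbsNorm
import Mathlib.Algebra.Polynomial.SpecificDegree
import Mathlib.RingTheory.Polynomial.RationalRoot
import Mathlib.Algebra.Squarefree.Basic
import HarnessLib

/-!
# BirchSwinnertonDyer — rank ≥ 2 observatory: prime elements of prime-power norm and small certificates for a cubic field

HONEST FRAMING: per-curve certified theorems and census instruments; no claim on BSD in rank ≥ 2.

Generic file of the KERNEL-2DESC instrument (design `b2b-bsdr2-cert-3/KERNEL-2DESC.md` §4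
A5(ii)–(iii)): the residue-map criterion for PRIME GENERATORS of primes of residue degree `2`
and `3`, and the small decidable certificates used by the per-field files.

* `exists_ringHom_zmod_of_absNorm_eq`: an ideal of prime norm `p` is the kernel of a ring map
  `𝓞 K → ℤ/p` (a ring of prime order is `ℤ/p`);
* `prime_of_natAbs_norm_eq_prime_pow`: if `|N(x)| = p²` or `p³` and NO ring map `𝓞 K → ℤ/p`
  kills `x`, then `x` is a prime element (its ideal has no factor of residue degree one, so it
  is a single prime of degree `2`, resp. `3`); the hypothesis is discharged by the decidable
  residue certificate `ringHom_lin_ne_zero` ("`x(t) ≠ 0` at every root `t` of `f mod p`");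
* `irreducible_polyQ_of_divisors`: the rational root test for `X³ + AX² + BX + C` as a check over
  the divisors of `|C|`;
* `sqfree_cond_of_squarefree`: the square-factor condition of `MonicCubic.discr_eq_disc` /
  `exists_ringHom_of_root` (`𝓞 K = ℤ[θ]`) from `Δ(f)` squarefree.

Sorry-free; axioms `propext`, `Classical.choice`, `Quot.sound`. Mathematics: Marcus, *Number
Fields* (2nd ed.), Ch. 3 (Thm. 22: `‖(x)‖ = |N(x)|`; residue degrees), folklore.
-/

-- single-conjunct summit: `Summit.BirchSwinnertonDyer.BirchSwinnertonDyer.…` repeats the name by design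
set_option linter.dupNamespace false

noncomputable section

open scoped Classical NumberField

open Literature.NumberTheory.NumberFields Polynomial Module NumberField

namespace Summit.BirchSwinnertonDyer.BirchSwinnertonDyer.Rank2Observatory.TwoDescCubic

section NormPrime

variable {K : Type*} [Field K] [NumberField K]

/-- **An ideal of prime norm is the kernel of a map to `ℤ/p`** (`𝓞 K ⧸ J` is a ring with `p`
elements). [cite: Marcus2018, Ch. 3, Thm. 22] -/
theorem exists_ringHom_zmod_of_absNorm_eq {J : Ideal (𝓞 K)} {p : ℕ} (hp : p.Prime)
    (hJ : Ideal.absNorm J = p) : ∃ ψ : 𝓞 K →+* ZMod p, ∀ y ∈ J, ψ y = 0 := by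
  have hfin : Finite (𝓞 K ⧸ J) := (Ideal.absNorm_ne_zero_iff J).mp (by rw [hJ]; exact hp.ne_zero)
  letI : Fintype (𝓞 K ⧸ J) := Fintype.ofFinite _
  have hcard : Fintype.card (𝓞 K ⧸ J) = p := by
    rw [← Nat.card_eq_fintype_card, ← Submodule.cardQuot_apply, ← Ideal.absNorm_apply, hJ]
  let e : ZMod p ≃+* 𝓞 K ⧸ J := ZMod.ringEquivOfPrime (𝓞 K ⧸ J) hp hcard
  refine ⟨e.symm.toRingHom.comp (Ideal.Quotient.mk J), fun y hy => ?_⟩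
  rw [RingHom.comp_apply, Ideal.Quotient.eq_zero_iff_mem.mpr hy]
  exact map_zero _

/-- **Prime generators of residue degree `2` or `3`**: if `|N(x)| = p^k` with `k ∈ {2, 3}` and no
ring map `𝓞 K → ℤ/p` kills `x`, then `x` is a prime element. (A maximal ideal above `(x)` has
norm `p^j`, `j ≥ 2` since `j = 1` would give such a map; the cofactor then has norm `1` or `p`,
and norm `p` again gives such a map.) [cite: Marcus2018, Ch. 3, Thm. 22] -/
theorem prime_of_natAbs_norm_eq_prime_pow {x : 𝓞 K} {p k : ℕ} (hp : p.Prime) (hk : k = 2 ∨ k = 3)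
    (hN : (Algebra.norm ℤ x).natAbs = p ^ k) (hψ : ∀ ψ : 𝓞 K →+* ZMod p, ψ x ≠ 0) : Prime x := by
  set I : Ideal (𝓞 K) := Ideal.span {x} with hI
  have hIN : Ideal.absNorm I = p ^ k := by rw [hI, Ideal.absNorm_span_singleton, hN]
  have hx0 : x ≠ 0 := by
    rintro rfl
    rw [Algebra.norm_zero, Int.natAbs_zero] at hN
    exact pow_ne_zero k hp.ne_zero hN.symm
  have hItop : I ≠ ⊤ := by
    intro h
    rw [h, Ideal.absNorm_top] at hIN
    have h1 : p ^ k ≠ 1 := by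
      rw [Ne, Nat.pow_eq_one]
      push Not
      exact ⟨hp.ne_one, by omega⟩
    exact h1 hIN.symm
  -- no ideal of norm `p` contains `x`
  have hnoJ : ∀ J : Ideal (𝓞 K), Ideal.absNorm J = p → x ∉ J := by
    intro J hJ hxJ
    obtain ⟨ψ, hψJ⟩ := exists_ringHom_zmod_of_absNorm_eq hp hJ
    exact hψ ψ (hψJ x hxJ)
  obtain ⟨P, hPmax, hIP⟩ := Ideal.exists_le_maximal I hItop
  have hPdvd : Ideal.absNorm P ∣ p ^ k := hIN ▸ Ideal.absNorm_dvd_absNorm_of_le hIP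
  obtain ⟨j, hjk, hPj⟩ := (Nat.dvd_prime_pow hp).mp hPdvd
  have hxI : x ∈ I := Ideal.mem_span_singleton_self x
  have hxP : x ∈ P := hIP hxI
  have hj0 : j ≠ 0 := by
    rintro rfl
    rw [pow_zero, Ideal.absNorm_eq_one_iff] at hPj
    exact hPmax.ne_top hPj
  have hj1 : j ≠ 1 := by
    rintro rfl
    rw [pow_one] at hPj
    exact hnoJ P hPj hxP
  obtain ⟨J, hIJ⟩ := Ideal.dvd_iff_le.mpr hIP
  have hJN : p ^ j * Ideal.absNorm J = p ^ j * p ^ (k - j) := by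
    rw [← hPj, ← map_mul, ← hIJ, hIN, hPj, ← pow_add]
    congr 1
    omega
  have hJ' : Ideal.absNorm J = p ^ (k - j) :=
    Nat.eq_of_mul_eq_mul_left (pow_pos hp.pos j) hJN
  have hkj : k - j = 0 ∨ k - j = 1 := by omega
  rcases hkj with h0 | h1
  · -- `J = ⊤`, so `(x) = P` is prime
    rw [h0, pow_zero, Ideal.absNorm_eq_one_iff] at hJ'
    rw [hJ', Ideal.mul_top] at hIJ
    rw [← Ideal.span_singleton_prime hx0, ← hI, hIJ]
    exact hPmax.isPrime
  · -- a cofactor of norm `p` would contain `x`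
    rw [h1, pow_one] at hJ'
    have hxJ : x ∈ J := (hIJ ▸ Ideal.mul_le_left (I := P) (J := J)) hxI
    exact absurd hxJ (hnoJ J hJ')

/-- **The residue certificate**: a ring map `ψ : 𝓞 K → ℤ/p` sends `θ` to a root of `f mod p`,
so `ψ(c₀ + c₁θ + c₂θ²) ≠ 0` as soon as `c₀ + c₁t + c₂t² ≠ 0` at every root `t ∈ ℤ/p` of `f`
(a `decide`-able check). [folklore] -/
theorem ringHom_lin_ne_zero {a b c : ℤ} {θ : K} (hθ : aeval θ (MonicCubic.poly a b c) = 0)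
    {p : ℕ} (ψ : 𝓞 K →+* ZMod p) (c₀ c₁ c₂ : ℤ)
    (hcert : ∀ t : ZMod p, t ^ 3 + (a : ZMod p) * t ^ 2 + (b : ZMod p) * t + (c : ZMod p) = 0 →
      (c₀ : ZMod p) + (c₁ : ZMod p) * t + (c₂ : ZMod p) * t ^ 2 ≠ 0) :
    ψ ((c₀ : 𝓞 K) + (c₁ : 𝓞 K) * MonicCubic.thetaInt hθ +
      (c₂ : 𝓞 K) * MonicCubic.thetaInt hθ ^ 2) ≠ 0 := by
  have hroot := congrArg ψ (MonicCubic.thetaInt_rel hθ)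
  simp only [map_add, map_mul, map_pow, map_intCast, map_zero] at hroot
  have h := hcert _ hroot
  simpa only [map_add, map_mul, map_pow, map_intCast] using h

end NormPrime

/-! ## Small certificates -/

section Small

/-- **Rational root test over the divisors of `|C|`**: `X³ + AX² + BX + C` (`C ≠ 0`) is
irreducible over `ℚ` if `±d` is not a root for every `d ∣ |C|` (integral root theorem).
[folklore] -/
theorem irreducible_polyQ_of_divisors {a b c : ℤ} (hc : c ≠ 0)
    (h : ∀ d ∈ Nat.divisors c.natAbs,
      (d : ℤ) ^ 3 + a * (d : ℤ) ^ 2 + b * d + c ≠ 0 ∧ -(d : ℤ) ^ 3 + a * (d : ℤ) ^ 2 - b * d + c ≠ 0) :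
    Irreducible (MonicCubic.polyQ a b c) := by
  rw [MonicCubic.polyQ_eq]
  set f : ℚ[X] := X ^ 3 + C (a : ℚ) * X ^ 2 + C (b : ℚ) * X + C (c : ℚ) with hf
  have hdeg : f.natDegree = 3 := by rw [hf]; compute_degree!
  rw [irreducible_iff_roots_eq_zero_of_degree_le_three (by omega) (by omega)]
  refine Multiset.eq_zero_of_forall_notMem fun r hr => ?_
  have hf0 : f ≠ 0 := by rintro h0; rw [h0, natDegree_zero] at hdeg; exact absurd hdeg (by decide)
  rw [mem_roots hf0, IsRoot.def, hf] at hr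
  simp only [eval_add, eval_pow, eval_X, eval_mul, eval_C] at hr
  set fZ : ℤ[X] := X ^ 3 + C a * X ^ 2 + C b * X + C c with hfZ
  have hmonic : fZ.Monic := by rw [hfZ]; monicity!
  have haeval : aeval r fZ = 0 := by
    rw [hfZ]
    simp only [map_add, map_pow, aeval_X, map_mul, map_intCast, eq_intCast]
    exact_mod_cast hr
  obtain ⟨n, hn, hdvd⟩ := exists_integer_of_is_root_of_monic hmonic haeval
  have hc0 : fZ.coeff 0 = c := by rw [hfZ]; simp
  rw [hc0] at hdvd
  rw [hn, algebraMap_int_eq, eq_intCast] at hr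
  have hr' : n ^ 3 + a * n ^ 2 + b * n + c = 0 := by exact_mod_cast hr
  have hd : n.natAbs ∈ Nat.divisors c.natAbs :=
    Nat.mem_divisors.mpr ⟨Int.natAbs_dvd_natAbs.mpr hdvd, Int.natAbs_ne_zero.mpr hc⟩
  obtain ⟨h1, h2⟩ := h _ hd
  rcases Int.natAbs_eq n with hn' | hn'
  · rw [hn'] at hr'
    exact h1 hr'
  · rw [hn'] at hr'
    apply h2
    linear_combination hr'

/-- **The square-factor condition from a squarefree discriminant**: if `Δ(f)` is squarefree,
the hypothesis `hsq` of `MonicCubic.discr_eq_disc` / `MonicCubic.exists_ringHom_of_root`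
(`𝓞 K = ℤ[θ]`) holds. [cite: Marcus2018, Ch. 2, Ex. 27] -/
theorem sqfree_cond_of_squarefree {a b c : ℤ} (h : Squarefree (MonicCubic.disc a b c)) :
    ∀ r e : ℤ, MonicCubic.disc a b c = r ^ 2 * e → 2 < |e| → IsUnit r :=
  fun r e hre _ => h r ⟨e, by rw [hre]; ring⟩

end Small

end Summit.BirchSwinnertonDyer.BirchSwinnertonDyer.Rank2Observatory.TwoDescCubic

end
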